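import Summits.RiemannHypothesis.RiemannHypothesis.Theses.WeilWindowFlow
import Summits.RiemannHypothesis.RiemannHypothesis.Theorems.WeilWindowFlowWindowLipschitz
import Summits.RiemannHypothesis.RiemannHypothesis.Theorems.WeilWindowFlowLipschitzDerivGlue
import Summits.RiemannHypothesis.RiemannHypothesis.Theorems.WeilWindowFlowDiniLeakageCalibration
import Summits.RiemannHypothesis.RiemannHypothesis.Theorems.WeilWindowFlowGronwallLeakageStrictAnti
import Summits.RiemannHypothesis.RiemannHypothesis.Theorems.WeilWindowFlowGronwallLeakageCalibration
import Summits.RiemannHypothesis.RiemannHypothesis.Theorems.SpectralTraceWindowStepConjugateSplit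
import Literature.NumberTheory.LFunctions.WeilFirstPrimePositivityC
import HarnessLib

/-!
# Grönwall transport of the window bottom from the PROVED small-window base — typed targets
# (pub-rhpf, transport-1, leaf G1.22 'TRANSPORT'; RH-free glue; def-free)

**mechanism/rigidity campaign; no RH claims.**  Companion text:
`run/shared/lean/pub/pub-rhpf/pub-rhpf-transport-1/TRANSPORT.md`.

Setting (`Literature.NumberTheory.LFunctions`): `ε(a) = weilGroundEnergy a` is the bottom of `Re weilQuadratic`
over unit Weil tests of the window `[-a, a]`; the PROVED base is Weil positivity on `[-a, a]` for
`a ≤ (log 3)/2` (`weilPositivityOn_log_three_half`), which gives the STRICT seed `0 < ε(a₀)` for every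
`0 < a₀ < (log 3)/2` (`weilGroundEnergy_pos_of_weilPositivityOn_of_lt`, strict antitonicity of `ε`).

The transport programme asks for an input `−ε′(a) ≤ K(a) ε(a)` (`K` locally bounded) on `[a₀, ∞)`; this file
records, sorry-free and WITHOUT new definitions, what such an input buys:

* `derivLeakage_of_rateBoundFrom` — a rate bound from ONE seed window `a₀ < (log 3)/2` with ANY locally
  bounded rate `K` already gives the route item `WeilWindowFlow.DerivLeakage` (item 14754) on every compact
  range `[b₀, A]` (below the seed the PROVED one-sided Lipschitz bound `WindowLipschitz_proof`, item 1039,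
  and the strict seed do the work);
* `riemannHypothesis_of_rateBoundFrom` — hence the Riemann hypothesis (`lipschitzDerivGlue_proof`, item
  14755, + `riemannHypothesis_of_diniLeakage`): EVERY differential transport input of this shape is
  RH-strength, whatever `K` is;
* `riemannHypothesis_of_archRateBoundFrom` — the instance `K(a) = 8π e^{2a}` (the sharp archimedean rate:
  DATA `−ε′/ε = (0.67 … 0.995)·8π e^{2a}` on the served converged ζ ladder `a ∈ [0.31, 2.05]`,
  TRANSPORT.md §4 T-B), i.e. "`a ↦ e^{4π e^{2a}} ε(a)` is non-decreasing past the seed", implies RH;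
* `riemannHypothesis_of_transportFrom` / `riemannHypothesis_of_archTransportFrom` — the INTEGRATED form:
  any positive factor `F` with `ε(a₀) F(a) ≤ ε(a)` for `a ≥ a₀` (one seed, not every base as in
  `riemannHypothesis_of_nonneg_transport`) implies RH, in particular
  `ε(a) ≥ c · ε(a₀) exp(−4π(e^{2a} − e^{2a₀}))` with any constant `0 < c`
  (`riemannHypothesis_of_archTransportFrom'`, the quasi-monotone DATA law of record).

Nothing here is specific to ζ beyond the tree facts quoted; no converse (RH ⇒ sharp rate) is claimed.
-/

noncomputable section

set_option linter.dupNamespace false  -- D-0017 nested layout: `RiemannHypothesis.RiemannHypothesis`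

namespace Summit.RiemannHypothesis.RiemannHypothesis.Theorems.PfPersistenceTransport

open Set Filter Topology
open _root_.Literature.NumberTheory.LFunctions
open _root_.Summit.RiemannHypothesis.RiemannHypothesis.Theses.WeilWindowFlow
open _root_.Summit.RiemannHypothesis.RiemannHypothesis.Theorems.WeilWindowFlowWindowLipschitz
  (WindowLipschitz_proof windowLipschitz_antitone)
open _root_.Summit.RiemannHypothesis.RiemannHypothesis.Theorems.WeilWindowFlowLipschitzDerivGlue
  (lipschitzDerivGlue_proof)
open _root_.Summit.RiemannHypothesis.RiemannHypothesis.Theorems.WeilWindowFlowDiniLeakage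
  (riemannHypothesis_of_diniLeakage)
open _root_.Summit.RiemannHypothesis.RiemannHypothesis.Theorems.WeilWindowFlowGronwallLeakage
  (weilGroundEnergy_pos_of_weilPositivityOn_of_lt strictPos_iff_riemannHypothesis)
open _root_.Summit.RiemannHypothesis.RiemannHypothesis.Theorems.SpectralTraceWindowStep
  (weilGroundEnergy_pos_of_lt_log_three_half')

/-! ## 0. Real-analysis glue: a left drop bound controls the derivative -/

/-- If `f b − f a ≤ M (a − b)` for all `b ∈ [c, a)` (`c < a`) and `f` is differentiable at `a`, then
`−f′(a) ≤ M`. (Same statement as `neg_deriv_le_of_left_drop_le` of the crux workfile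
`Cruxes/DerivLeakage/Calibration.lean`; re-proved here so that this file imports Theorems only.) [folklore] -/
theorem neg_deriv_le_of_left_drop_le' {f : ℝ → ℝ} {c a M : ℝ} (hca : c < a)
    (hf : DifferentiableAt ℝ f a) (h : ∀ b : ℝ, c ≤ b → b < a → f b - f a ≤ M * (a - b)) :
    -deriv f a ≤ M := by
  have ht : Tendsto (slope f a) (𝓝[<] a) (𝓝 (deriv f a)) :=
    hf.hasDerivAt.tendsto_slope.mono_left (nhdsLT_le_nhdsNE a)
  have hev : ∀ᶠ b in 𝓝[<] a, -M ≤ slope f a b := by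
    filter_upwards [Ioo_mem_nhdsLT hca] with b hb
    rw [slope_def_field, le_div_iff_of_neg (sub_neg.2 hb.2)]
    have := h b hb.1.le hb.2
    nlinarith
  linarith [ge_of_tendsto ht hev]

/-! ## 1. The strict seed below Yoshida's rung: `0 < ε(a₀)` for `0 < a₀ < (log 3)/2` is the LANDED
`SpectralTraceWindowStep.weilGroundEnergy_pos_of_lt_log_three_half'` (PROVED base
`weilPositivityOn_log_three_half` + strict antitonicity); it is used below by name. -/

/-! ## 2. A differential rate bound from one seed gives `DerivLeakage`, hence RH -/

/-- **Rate bound from a seed ⇒ item 14754.** If past a seed window `a₀ < (log 3)/2` the bottom leaks at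
a locally bounded relative rate, `−ε′(a) ≤ K(a) ε(a)` at every differentiability window with `ε(a) > 0`,
then `DerivLeakage` holds on every compact range: below the seed use `WindowLipschitz_proof` (item 1039)
and `ε(a) ≥ ε(a₀) > 0`. [folklore] -/
theorem derivLeakage_of_rateBoundFrom {a₀ : ℝ} (ha₀ : 0 < a₀) (ha₀' : a₀ < Real.log 3 / 2)
    (K : ℝ → ℝ) (hK : ∀ A : ℝ, ∃ M : ℝ, ∀ a : ℝ, a₀ ≤ a → a ≤ A → K a ≤ M)
    (h : ∀ a : ℝ, a₀ ≤ a → 0 < weilGroundEnergy a → DifferentiableAt ℝ weilGroundEnergy a →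
      -deriv weilGroundEnergy a ≤ K a * weilGroundEnergy a) :
    DerivLeakage := by
  intro b₀ A hb₀ hA
  obtain ⟨L, hL⟩ := WindowLipschitz_proof (b₀ / 2) A (by positivity) (by linarith)
  obtain ⟨M, hM⟩ := hK A
  have hweilGroundEnergy₀ : 0 < weilGroundEnergy a₀ := weilGroundEnergy_pos_of_lt_log_three_half' ha₀ ha₀'
  refine ⟨max (max M 0) (max L 0 / weilGroundEnergy a₀), fun a hba haA hpos hdiff ↦ ?_⟩
  by_cases hcase : a₀ ≤ a
  · calc -deriv weilGroundEnergy a ≤ K a * weilGroundEnergy a := h a hcase hpos hdiff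
      _ ≤ max M 0 * weilGroundEnergy a :=
          mul_le_mul_of_nonneg_right ((hM a hcase haA).trans (le_max_left _ _)) hpos.le
      _ ≤ max (max M 0) (max L 0 / weilGroundEnergy a₀) * weilGroundEnergy a :=
          mul_le_mul_of_nonneg_right (le_max_left _ _) hpos.le
  · have ha0 : 0 < a := hb₀.trans_le hba
    have hlt : a < a₀ := lt_of_not_ge hcase
    have key : -deriv weilGroundEnergy a ≤ max L 0 :=
      neg_deriv_le_of_left_drop_le' (c := b₀ / 2) (by linarith) hdiff fun b hb hblt ↦
        (hL b a hb hblt.le haA).trans (mul_le_mul_of_nonneg_right (le_max_left _ _) (by linarith))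
    have hweilGroundEnergya : weilGroundEnergy a₀ ≤ weilGroundEnergy a := windowLipschitz_antitone ha0 hlt.le
    calc -deriv weilGroundEnergy a ≤ max L 0 := key
      _ = max L 0 / weilGroundEnergy a₀ * weilGroundEnergy a₀ := by field_simp
      _ ≤ max L 0 / weilGroundEnergy a₀ * weilGroundEnergy a :=
          mul_le_mul_of_nonneg_left hweilGroundEnergya (div_nonneg (le_max_right _ _) hweilGroundEnergy₀.le)
      _ ≤ max (max M 0) (max L 0 / weilGroundEnergy a₀) * weilGroundEnergy a :=
          mul_le_mul_of_nonneg_right (le_max_right _ _) hpos.le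

/-- **Every differential transport input is RH-strength.** A rate bound from one seed with any locally
bounded rate implies the Riemann hypothesis (`lipschitzDerivGlue_proof`, item 14755, with
`WindowLipschitz_proof`, item 1039, then `riemannHypothesis_of_diniLeakage`). [folklore] -/
theorem riemannHypothesis_of_rateBoundFrom {a₀ : ℝ} (ha₀ : 0 < a₀) (ha₀' : a₀ < Real.log 3 / 2)
    (K : ℝ → ℝ) (hK : ∀ A : ℝ, ∃ M : ℝ, ∀ a : ℝ, a₀ ≤ a → a ≤ A → K a ≤ M)
    (h : ∀ a : ℝ, a₀ ≤ a → 0 < weilGroundEnergy a → DifferentiableAt ℝ weilGroundEnergy a →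
      -deriv weilGroundEnergy a ≤ K a * weilGroundEnergy a) :
    _root_.RiemannHypothesis :=
  riemannHypothesis_of_diniLeakage
    (lipschitzDerivGlue_proof WindowLipschitz_proof (derivLeakage_of_rateBoundFrom ha₀ ha₀' K hK h))

/-- **The sharp archimedean rate (TRANSPORT.md T-B).** If past a seed `a₀ < (log 3)/2` the bottom never
leaks faster than `8π e^{2a}` per unit `a` — equivalently `a ↦ exp(4π e^{2a}) · ε(a)` is non-decreasing
where `ε > 0` — then RH. DATA (pub-weilobs tables v1.6.10, ζ, two engines, converged rows):
`−ε′/ε ∈ [0.67, 0.995] · 8π e^{2a}` on `a ∈ [0.31, 2.05]`. No converse is claimed. [folklore] -/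
theorem riemannHypothesis_of_archRateBoundFrom {a₀ : ℝ} (ha₀ : 0 < a₀) (ha₀' : a₀ < Real.log 3 / 2)
    (h : ∀ a : ℝ, a₀ ≤ a → 0 < weilGroundEnergy a → DifferentiableAt ℝ weilGroundEnergy a →
      -deriv weilGroundEnergy a ≤ 8 * Real.pi * Real.exp (2 * a) * weilGroundEnergy a) :
    _root_.RiemannHypothesis := by
  refine riemannHypothesis_of_rateBoundFrom ha₀ ha₀' (fun a ↦ 8 * Real.pi * Real.exp (2 * a))
    (fun A ↦ ⟨8 * Real.pi * Real.exp (2 * max A a₀), fun a _ haA ↦ ?_⟩) h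
  have : Real.exp (2 * a) ≤ Real.exp (2 * max A a₀) :=
    Real.exp_le_exp.2 (by linarith [le_max_left A a₀])
  exact mul_le_mul_of_nonneg_left this (by positivity)

/-! ## 3. The integrated form: one positive transport factor from one seed gives RH -/

/-- **Transport from ONE seed ⇒ RH.** If `ε(a₀) · F(a) ≤ ε(a)` for all `a ≥ a₀` with `F > 0` and
`0 < a₀ < (log 3)/2`, then `0 < ε(a)` at every window (`a < a₀`: PROVED base; `a ≥ a₀`: the seed is
strictly positive), which is RH (`strictPos_iff_riemannHypothesis`). Compare
`riemannHypothesis_of_nonneg_transport` (transport from EVERY base, factor `≥ 0`). [folklore] -/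
theorem riemannHypothesis_of_transportFrom {a₀ : ℝ} (ha₀ : 0 < a₀) (ha₀' : a₀ < Real.log 3 / 2)
    (F : ℝ → ℝ) (hF : ∀ a : ℝ, a₀ ≤ a → 0 < F a)
    (h : ∀ a : ℝ, a₀ ≤ a → weilGroundEnergy a₀ * F a ≤ weilGroundEnergy a) :
    _root_.RiemannHypothesis := by
  refine strictPos_iff_riemannHypothesis.1 fun a ha ↦ ?_
  by_cases hcase : a₀ ≤ a
  · exact lt_of_lt_of_le (mul_pos (weilGroundEnergy_pos_of_lt_log_three_half' ha₀ ha₀') (hF a hcase)) (h a hcase)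
  · exact weilGroundEnergy_pos_of_weilPositivityOn_of_lt weilPositivityOn_log_three_half ha
      ((lt_of_not_ge hcase).trans ha₀')

/-- **Integrated archimedean transport (TRANSPORT.md T-B, integrated).**
`ε(a) ≥ ε(a₀) · exp(−4π (e^{2a} − e^{2a₀}))` for `a ≥ a₀` (one seed `a₀ < (log 3)/2`) implies RH. [folklore] -/
theorem riemannHypothesis_of_archTransportFrom {a₀ : ℝ} (ha₀ : 0 < a₀) (ha₀' : a₀ < Real.log 3 / 2)
    (h : ∀ a : ℝ, a₀ ≤ a →
      weilGroundEnergy a₀ * Real.exp (-(4 * Real.pi * (Real.exp (2 * a) - Real.exp (2 * a₀)))) ≤ weilGroundEnergy a) :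
    _root_.RiemannHypothesis :=
  riemannHypothesis_of_transportFrom ha₀ ha₀' _ (fun _ _ ↦ Real.exp_pos _) h

/-- **Quasi-monotone integrated archimedean transport** (the DATA law of record, TRANSPORT.md §4 T-B∫: with a
constant `0 < c ≤ 1` absorbing the fine-structure dips of `e^{4π e^{2a}} ε(a)` just after prime onsets `a = ½ log p`):
`ε(a) ≥ c · ε(a₀) · exp(−4π (e^{2a} − e^{2a₀}))` for `a ≥ a₀` (one seed `a₀ < (log 3)/2`) implies RH. [folklore] -/
theorem riemannHypothesis_of_archTransportFrom' {a₀ c : ℝ} (ha₀ : 0 < a₀) (ha₀' : a₀ < Real.log 3 / 2)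
    (hc : 0 < c)
    (h : ∀ a : ℝ, a₀ ≤ a →
      c * weilGroundEnergy a₀ * Real.exp (-(4 * Real.pi * (Real.exp (2 * a) - Real.exp (2 * a₀)))) ≤ weilGroundEnergy a) :
    _root_.RiemannHypothesis :=
  riemannHypothesis_of_transportFrom ha₀ ha₀'
    (fun a ↦ c * Real.exp (-(4 * Real.pi * (Real.exp (2 * a) - Real.exp (2 * a₀)))))
    (fun _ _ ↦ mul_pos hc (Real.exp_pos _))
    (fun a ha ↦ by
      calc weilGroundEnergy a₀ * (c * Real.exp (-(4 * Real.pi * (Real.exp (2 * a) - Real.exp (2 * a₀)))))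
          = c * weilGroundEnergy a₀ * Real.exp (-(4 * Real.pi * (Real.exp (2 * a) - Real.exp (2 * a₀)))) := by ring
        _ ≤ weilGroundEnergy a := h a ha)

/-- Summit-level packaging of `riemannHypothesis_of_archRateBoundFrom`. [folklore] -/
theorem summit_of_archRateBoundFrom {a₀ : ℝ} (ha₀ : 0 < a₀) (ha₀' : a₀ < Real.log 3 / 2)
    (h : ∀ a : ℝ, a₀ ≤ a → 0 < weilGroundEnergy a → DifferentiableAt ℝ weilGroundEnergy a →
      -deriv weilGroundEnergy a ≤ 8 * Real.pi * Real.exp (2 * a) * weilGroundEnergy a) :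
    _root_.Summit.RiemannHypothesis :=
  (_root_.Summit.RiemannHypothesis_iff).2 (riemannHypothesis_of_archRateBoundFrom ha₀ ha₀' h)

end Summit.RiemannHypothesis.RiemannHypothesis.Theorems.PfPersistenceTransport

end
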